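import Summits.ValiantsHypothesis.ValiantsHypothesis.Theses.ElementaryWordLength
import Literature.Computability.AlgebraicComplexity.HessianRank

/-!
Sketch for crux-ideate stmt-ValiantsHypothesis-6627 (ElementaryWordLength.UnboundedReads).
First lemmas of two idea cards; statements only (sorried), they must elaborate.
-/

noncomputable section

open Literature.Computability.AlgebraicComplexity

namespace Summit.ValiantsHypothesis.ValiantsHypothesis.Cruxes.UnboundedReads.Sketch

/-- The letter semantics used by the route (copied verbatim from the route file). -/
abbrev letterMat {σ : Type} (l : Fin 3 × Fin 3 × ℂ × Option σ) :
    Matrix (Fin 3) (Fin 3) (MvPolynomial σ ℂ) :=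
  Matrix.transvection l.1 l.2.1 (MvPolynomial.C l.2.2.1 * l.2.2.2.elim 1 MvPolynomial.X)

/-! ### Card `diagonal-jacobian-segments` — first lemma (the transfer statement C⁺). -/

/-- **C⁺ (DiagonalLettersQuadratic).** Every affine elementary word for `E_02(per_n)` contains at
least `n(n-1)/18 - 1` letters carrying a DIAGONAL variable `x_ii`: the Jacobian of the
`n(n-1)/2` coefficient functions `x_ab x_ba` (coefficients of `∏_{i ∉ {a,b}} x_ii` in `per_n`)
has rank `n(n-1)/2`, and factors through the `9(ℓ+1)` entries of the `ℓ+1` diagonal-free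
segments of the word. No `n₀`: the inequality holds for every `n`. -/
theorem diagLetters_quadratic (n : ℕ)
    (w : List (Fin 3 × Fin 3 × ℂ × Option (Fin n × Fin n)))
    (hw : ∀ l ∈ w, l.1 ≠ l.2.1)
    (hprod : (w.map (fun l => Matrix.transvection l.1 l.2.1
        (MvPolynomial.C l.2.2.1 * l.2.2.2.elim 1 MvPolynomial.X))).prod
      = Matrix.transvection (0 : Fin 3) 2 (perPoly (Fin n) ℂ)) :
    n * (n - 1) ≤ 18 * ((w.filter (fun l => decide (∃ i : Fin n, l.2.2.2 = some (i, i)))).length + 1) := by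
  sorry

/-- Counting helper: if every element satisfying `P` satisfies some `Q i`, the `P`-filter is no
longer than the sum of the `Q i`-filters. -/
theorem filter_length_le_sum {α ι : Type} [Fintype ι] [DecidableEq ι] (w : List α) (P : α → Bool)
    (Q : ι → α → Bool) (hPQ : ∀ a, P a = true → ∃ i, Q i a = true) :
    (w.filter P).length ≤ ∑ i, (w.filter (Q i)).length := by
  induction w with
  | nil => simp
  | cons a w ih =>
    simp only [List.filter_cons]
    have hmono : ∀ j, (w.filter (Q j)).length ≤
        (if Q j a = true then a :: w.filter (Q j) else w.filter (Q j)).length := fun j => by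
      split <;> simp
    by_cases hP : P a = true
    · obtain ⟨i, hi⟩ := hPQ a hP
      have hi' : (w.filter (Q i)).length + 1 ≤
          (if Q i a = true then a :: w.filter (Q i) else w.filter (Q i)).length := by simp [hi]
      rw [if_pos hP, List.length_cons]
      calc (w.filter P).length + 1 ≤ (∑ j, (w.filter (Q j)).length) + 1 := by omega
        _ = (∑ j ∈ Finset.univ.erase i, (w.filter (Q j)).length) + ((w.filter (Q i)).length + 1) := by
            rw [← Finset.sum_erase_add _ _ (Finset.mem_univ i)]; ring
        _ ≤ (∑ j ∈ Finset.univ.erase i,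
              (if Q j a = true then a :: w.filter (Q j) else w.filter (Q j)).length) +
            (if Q i a = true then a :: w.filter (Q i) else w.filter (Q i)).length :=
            add_le_add (Finset.sum_le_sum fun j _ => hmono j) hi'
        _ = ∑ j, (if Q j a = true then a :: w.filter (Q j) else w.filter (Q j)).length := by
            rw [← Finset.sum_erase_add _ _ (Finset.mem_univ i)]
    · rw [if_neg hP]
      exact le_trans ih (Finset.sum_le_sum fun j _ => hmono j)

/-- The transfer `C⁺ → UnboundedReads` is pigeonhole over the `n` diagonal variables
(`n(n-1) ≤ 18(ℓ+1)` and `ℓ ≤ k·n` are incompatible once `n ≥ 18k + 20`). PROVED here (kernel-checked glue). -/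
theorem unboundedReads_of_diagLetters_quadratic
    (h : ∀ n : ℕ, ∀ w : List (Fin 3 × Fin 3 × ℂ × Option (Fin n × Fin n)),
      (∀ l ∈ w, l.1 ≠ l.2.1) →
      (w.map (fun l => Matrix.transvection l.1 l.2.1
          (MvPolynomial.C l.2.2.1 * l.2.2.2.elim 1 MvPolynomial.X))).prod
        = Matrix.transvection (0 : Fin 3) 2 (perPoly (Fin n) ℂ) →
      n * (n - 1) ≤ 18 * ((w.filter (fun l => decide (∃ i : Fin n, l.2.2.2 = some (i, i)))).length + 1)) :
    Summit.ValiantsHypothesis.ValiantsHypothesis.Theses.ElementaryWordLength.UnboundedReads := by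
  intro k
  refine ⟨18 * k + 20, fun n hn w hw hprod => ?_⟩
  have hq := h n w hw hprod
  by_contra hcon
  push Not at hcon
  have hsum : (w.filter (fun l => decide (∃ i : Fin n, l.2.2.2 = some (i, i)))).length ≤
      ∑ i : Fin n, (w.filter (fun l => decide (l.2.2.2 = some (i, i)))).length :=
    filter_length_le_sum w _ (fun i l => decide (l.2.2.2 = some (i, i))) (by
      intro a ha
      simpa using ha)
  have hle : ∑ i : Fin n, (w.filter (fun l => decide (l.2.2.2 = some (i, i)))).length ≤ n * k := by
    calc ∑ i : Fin n, (w.filter (fun l => decide (l.2.2.2 = some (i, i)))).length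
        ≤ ∑ _i : Fin n, k := Finset.sum_le_sum fun i _ => hcon (i, i)
      _ = n * k := by simp
  have hnk : n * (n - 1) ≤ 18 * (n * k + 1) := by omega
  have h1 : 18 * k + 19 ≤ n - 1 := by omega
  have h2 : n * (18 * k + 19) ≤ n * (n - 1) := Nat.mul_le_mul_left n h1
  have h3 : n * (18 * k + 19) = 18 * (n * k) + 19 * n := by ring
  omega

/-- Word-side engine of C⁺ in its general form (segment factorisation + chain rule + rank):
for ANY polynomial `f` computed at entry `(0,2)` by a legal word, and any finite family of
"probe" coefficient-extraction functionals that are linear over the diagonal-free subring, the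
Jacobian (w.r.t. off-diagonal variables, evaluated at a point) of the probed coefficients has rank
at most `9·(ℓ+1)`, `ℓ` = number of diagonal letters.  Stated here in the concrete instance the
card needs: the probes are the `n(n-1)/2` coefficients of `∏_{i∉{a,b}} x_ii`, whose values on
`per_n` are `x_ab * x_ba`; the conclusion is phrased directly as the numeric rank inequality via
`Literature.Computability.AlgebraicComplexity.pderiv_aeval_eq_sum` (chain rule, in tree) and
`Matrix.rank_mul_le` / `Matrix.rank_le_card_width`. (Informal pointer; the typed statement is
`diagLetters_quadratic`.) -/
example : True := trivial

/-! ### Card `parity-cuts-rank-three` — first lemma (one-cut rank-3 in sum-of-products form). -/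

/-- **One cut, three products (Nisan's cut in the unipotent word model).** If a word is a
concatenation `u ++ v` where the variable letters of `u` carry only variables from `Y` and those
of `v` only variables from `Z`, then the `(0,2)` entry of its product is a sum of THREE products
`g_i * h_i` with `g_i ∈ ℂ[Y]`, `h_i ∈ ℂ[Z]` (namely `g_i = (∏u)_{0i}`, `h_i = (∏v)_{i2}`).
With `c` cuts the same expansion gives `3^c` products (paths through the cut indices). -/
theorem one_cut_three_products {σ : Type} (Y Z : Set σ)
    (u v : List (Fin 3 × Fin 3 × ℂ × Option σ))
    (hu : ∀ l ∈ u, ∀ x, l.2.2.2 = some x → x ∈ Y)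
    (hv : ∀ l ∈ v, ∀ x, l.2.2.2 = some x → x ∈ Z) :
    ∃ g h : Fin 3 → MvPolynomial σ ℂ,
      (∀ i, (↑(g i).vars : Set σ) ⊆ Y) ∧ (∀ i, (↑(h i).vars : Set σ) ⊆ Z) ∧
      ((u ++ v).map letterMat).prod 0 2 = ∑ i, g i * h i := by
  sorry

/-- **Per side for the cut line (2×2 blocks).** `∏_{t<r} (y_t z_t + 1)` is not a sum of fewer
than `2^r` products `g(y) · h(z)`: its coefficient matrix w.r.t. `Y | Z` is the `2^r × 2^r`
identity. (This is what `per_n` restricts to on `r` disjoint 2×2 blocks with off-block-diagonal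
cells set to `1`, a perfect matching of the leftover rows/columns set to `1`, all else `0`.) -/
theorem prod_pairs_rank (r m : ℕ) (hm : m < 2 ^ r)
    (g h : Fin m → MvPolynomial (Fin r ⊕ Fin r) ℂ)
    (hg : ∀ i, (↑(g i).vars : Set (Fin r ⊕ Fin r)) ⊆ Set.range Sum.inl)
    (hh : ∀ i, (↑(h i).vars : Set (Fin r ⊕ Fin r)) ⊆ Set.range Sum.inr) :
    (∏ t : Fin r, (MvPolynomial.X (Sum.inl t) * MvPolynomial.X (Sum.inr t) + 1)
        : MvPolynomial (Fin r ⊕ Fin r) ℂ) ≠ ∑ i, g i * h i := by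
  sorry

/-- **Combinatorial core of the cut line (parity cuts for read-k sequences), the shape needed.**
For a list over an alphabet split as `P ⊔ Q` in which every symbol occurs at least once and at
most `a` times (symbols of `P`) resp. `b` times (symbols of `Q`), there are at most `a + b - 1`
cut positions and sets `Y ⊆ P`, `Z ⊆ Q` with `|Y|,|Z| ≥ min(|P|,|Q|) / 4^(a+b-1)` such that every
occurrence of a `Y`-symbol lies in an even-indexed piece and every occurrence of a `Z`-symbol in an
odd-indexed piece (or vice versa).  Typed here for one alphabet `Fin N` with the parity classes
given by a cut list; proof by induction on `a + b` (see card). -/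
theorem parity_cuts (a b : ℕ) (N : ℕ) (P Q : Finset (Fin N)) (hPQ : Disjoint P Q)
    (s : List (Fin N))
    (hP : ∀ x ∈ P, 1 ≤ s.count x ∧ s.count x ≤ a) (hQ : ∀ x ∈ Q, 1 ≤ s.count x ∧ s.count x ≤ b)
    (ha : 1 ≤ a) (hb : 1 ≤ b) :
    ∃ (cuts : List ℕ) (Y Z : Finset (Fin N)),
      cuts.length ≤ a + b - 1 ∧ Y ⊆ P ∧ Z ⊆ Q ∧
      min P.card Q.card ≤ 4 ^ (a + b - 1) * Y.card ∧
      min P.card Q.card ≤ 4 ^ (a + b - 1) * Z.card ∧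
      -- parity purity: position `p` lies in piece number `(cuts.filter (· ≤ p)).length`
      (∃ e : ℕ, (∀ p : Fin s.length, s.get p ∈ Y → (cuts.filter (· ≤ (p : ℕ))).length % 2 = e % 2) ∧
                (∀ p : Fin s.length, s.get p ∈ Z → (cuts.filter (· ≤ (p : ℕ))).length % 2 ≠ e % 2)) := by
  sorry

end Summit.ValiantsHypothesis.ValiantsHypothesis.Cruxes.UnboundedReads.Sketch
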